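import Literature.Probability.RandomPlanarGeometry.SAWTriangularBridges
import HarnessLib

/-!
# `b_k(𝕋) · h_n(𝕋) ≤ h_{k+n}(𝕋)`: a bridge followed by a half-space walk is a half-space walk

Topic `Literature/Probability/RandomPlanarGeometry` (continues `SAWTriangularBridges.lean`: `brickBridges`, `brickHalfSpaceWalks`,
`Zd.concatWalk`, `concatWalk_mem_brickSaws`, `brickBridgeCount_mul_le : b_m b_n ≤ b_{m+n}`).  Source: N. Madras, G. Slade,
*The Self-Avoiding Walk* (1993), §1.2 eq. (1.2.15) (concatenation of bridges) and §3.3, proof of (3.3.38)–(3.3.39)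
(a bridge of length `l` followed by a half-space walk: `b_l h_n ≤ …`); Definition 3.1.2.  The `ℤ^d` statement in the tree is
`Zd.bridgeCount_mul_halfSpaceCount_le` (`SAWHalfSpaceConcat.lean`); this is the triangular-lattice (brick-frame) twin, the
super-multiplicativity input (lane face `TriBridgeHalfSpaceSup`) of the `N^{-1/3}` rate for `h_{N+1}(𝕋)/h_N(𝕋)`.

## Main statement (namespace `Literature.Probability.RandomPlanarGeometry.SAW`)

* **`brickBridgeCount_mul_brickHalfSpaceCount_le : b_k(𝕋) · h_n(𝕋) ≤ h_{k+n}(𝕋)`** for all `k, n`.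
-/

noncomputable section

open Finset Function Literature.Probability.LatticeModels Literature.Probability.Percolation SimpleGraph

namespace Literature.Probability.RandomPlanarGeometry.SAW

/-- **`b_k(𝕋) · h_n(𝕋) ≤ h_{k+n}(𝕋)`**: a bridge followed by a half-space walk started from its top is a half-space
walk (the bridge's points have heights in `(0, H]`, the appended ones in `(H, ∞)`), and the pair is recovered by
cutting at time `k`. [cite: MadrasSlade1993, §1.2 eq. (1.2.15) and §3.3 (3.3.38)–(3.3.39)] -/
theorem brickBridgeCount_mul_brickHalfSpaceCount_le (k n : ℕ) :
    brickBridgeCount k * brickHalfSpaceCount n ≤ brickHalfSpaceCount (k + n) := by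
  classical
  rw [brickBridgeCount, brickHalfSpaceCount, brickHalfSpaceCount, ← Finset.card_product]
  refine Finset.card_le_card_of_injOn (fun p => Zd.concatWalk k p.1 p.2) ?_ ?_
  · rintro ⟨β, υ⟩ hp
    simp only [Finset.mem_coe, Finset.mem_product, mem_brickBridges, mem_brickHalfSpaceWalks] at hp
    obtain ⟨⟨hβs, hβb⟩, hυs, hυh⟩ := hp
    have hβ0 : β 0 = 0 := (mem_brickSaws.1 hβs).1
    have hυ0 : υ 0 = 0 := (mem_brickSaws.1 hυs).1
    have hβ00 : β 0 0 = 0 := by rw [hβ0]; rfl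
    have hυ00 : υ 0 0 = 0 := by rw [hυ0]; rfl
    -- heights: bridge points `≤ β k 0`, appended points `> β k 0`
    have htop : ∀ i ≤ k, β i 0 ≤ β k 0 := by
      intro i hi
      rcases Nat.eq_zero_or_pos i with rfl | hpos
      · rcases Nat.eq_zero_or_pos k with hk | hk
        · rw [hk]
        · have h1 := (hβb k hk le_rfl).1
          exact h1.le
      · exact (hβb i hpos hi).2
    have hpos : ∀ j, 1 ≤ j → j ≤ n → 0 < υ j 0 := fun j hj1 hj2 => by
      have h1 := hυh j hj1 hj2
      rwa [hυ00] at h1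
    have hsep : ∀ i ≤ k, ∀ j, 1 ≤ j → j ≤ n → β i ≠ β k + υ j := by
      intro i hi j hj1 hj2 h
      have e := congrArg (fun y : Site 2 => y 0) h
      simp only [Pi.add_apply] at e
      have h1 := htop i hi
      have h2 := hpos j hj1 hj2
      linarith
    have hmem := concatWalk_mem_brickSaws hβs hυs hsep
    show Zd.concatWalk k β υ ∈ (brickHalfSpaceWalks (k + n) : Set (ℕ → Site 2))
    rw [Finset.mem_coe, mem_brickHalfSpaceWalks]
    refine ⟨hmem, fun i hi1 hi2 => ?_⟩
    show Zd.concatWalk k β υ 0 0 < Zd.concatWalk k β υ i 0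
    simp only [Zd.concatWalk, Nat.zero_le, if_true]
    by_cases hi : i ≤ k
    · rw [if_pos hi]; exact (hβb i hi1 hi).1
    · rw [if_neg hi, Pi.add_apply, hβ00]
      have h1 := hpos (i - k) (by omega) (by omega)
      have h2 := htop 0 (Nat.zero_le _)
      rw [hβ00] at h2
      linarith
  · rintro ⟨β, υ⟩ hp ⟨β', υ'⟩ hp' h
    simp only [Finset.mem_coe, Finset.mem_product, mem_brickBridges, mem_brickHalfSpaceWalks] at hp hp'
    obtain ⟨-, hβend, -, -⟩ := mem_brickSaws.1 hp.1.1
    obtain ⟨-, hβend', -, -⟩ := mem_brickSaws.1 hp'.1.1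
    have hυ0 : υ 0 = 0 := (mem_brickSaws.1 hp.2.1).1
    have hυ'0 : υ' 0 = 0 := (mem_brickSaws.1 hp'.2.1).1
    dsimp only at h
    have hβ : β = β' := by
      funext i
      rcases le_or_gt i k with hi | hi
      · have e := congrFun h i
        simpa [Zd.concatWalk, hi] using e
      · rw [hβend i hi.le, hβend' i hi.le]
        have e := congrFun h k
        simpa [Zd.concatWalk] using e
    have hk : β k = β' k := by rw [hβ]
    refine Prod.ext hβ ?_
    show υ = υ'
    funext j
    rcases Nat.eq_zero_or_pos j with hj | hj
    · rw [hj, hυ0, hυ'0]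
    · have e := congrFun h (k + j)
      simp only [Zd.concatWalk, show ¬ k + j ≤ k by omega, if_false, Nat.add_sub_cancel_left, hk] at e
      exact add_left_cancel e

end Literature.Probability.RandomPlanarGeometry.SAW
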